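import Mathlib
import HarnessLib
import Summits.ResolutionOfSingularities.ResolutionOfSingularities.Theorems.HomologicalConductorSurfaceTerminationChartResolutionBirational
import Summits.ResolutionOfSingularities.ResolutionOfSingularities.Theorems.HomologicalConductorPersistenceRadicalTower

/-!
# Route `HomologicalConductor`, kill test `SurfaceTermination` (stmt-ResolutionOfSingularities-16488):
# the chart dictionary of a resolution, part 4 — instantiation along the canonical tower

OURS (cell res-hironaka, crux chain W4.4, seat res-L0-w44-stub-1; object U2a «chart dictionary» of
res-D-pv-045's programme `stub_pgNonincreasing`; res-L0-w44-plan-1 (ρ13a)); nothing here is a statement of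
the manuscript under review (Hironaka 2017); AI-written, weaker than expert review.  SUPPORT-level, counted 0.

Two glue lemmas for consumers of parts 1–3 (`…ChartSections`, `…ChartResolution`,
`…ChartResolutionBirational`) along the tower `T_m = tower O A m`:

* `tower_succ_eq_loc_nrm_adjoin` — **the next stage IS `loc O N`** for the normalised affine chart ring
  `N = nrm (k[T_m ∪ I·x⁻¹])` of part 3's `exists_isResolution_chartMorphism` with `I = cohomologyAnnihilator ↥T_m`
  and `x ∈ ca T_m` admissible (the tree's `PersistenceRadical.tower_succ_eq_loc_nrm_affChart` transported
  along `setOf_ca_mul_inv_eq`); `T_(m+1)` is then a localisation of `N` by `SyzygyFlattening.isLocalization_locAt`,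
  so `isResolution_pullback_snd_of_isLocalization` yields a resolution of `Spec T_(m+1)`;
* `exists_functionField_ringEquiv` — the datum `(e, he)`: `K(Z) ≃ K` over `T` for a birational
  `ρ : Z ⟶ Spec T`, `Frac T = K` (the `CentreRing` idiom).

Def-free.

References: The Stacks Project, Tag 0307 [`StacksProject`]; R. Hartshorne, *Algebraic Geometry* (1977),
proof of Cor. III.11.4 [`Hartshorne1977`].
-/

noncomputable section

-- single-problem summit: the doubled namespace component `ResolutionOfSingularities` is forced
set_option linter.dupNamespace false

namespace Summit.ResolutionOfSingularities.ResolutionOfSingularities.Theorems.SurfaceTermination.ChartResolution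

open CategoryTheory AlgebraicGeometry
open Literature.AlgebraicGeometry.Resolution
open Summit.ResolutionOfSingularities.ResolutionOfSingularities.Theorems.NoZeno.Birth

variable {k K : Type} [Field k] [Field K] [Algebra k K]

/-- **`T_(m+1) = loc O (nrm k[T_m ∪ I·x⁻¹])` with `I = ca(↥T_m)` the cohomology-annihilator IDEAL** and
`x ∈ ca T_m` any admissible denominator (non-zero, of minimal `O`-value): the tree's
`PersistenceRadical.tower_succ_eq_loc_nrm_affChart` transported along `setOf_ca_mul_inv_eq`, so that the
`N` of `exists_isResolution_chartMorphism` (with `I := cohomologyAnnihilator ↥T_m`) is literally a model of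
the next stage: `T_(m+1) = loc O N`, a localisation of `N` (`SyzygyFlattening.isLocalization_locAt`).
[cite: StacksProject, Tag 0307] -/
theorem tower_succ_eq_loc_nrm_adjoin (O : ValuationSubring K) (A : Subalgebra k K) (m : ℕ)
    (hTO : (tower O A m).toSubring ≤ O.toSubring) (x : ↥(tower O A m)) (hx : (x : K) ∈ ca (tower O A m))
    (hx0 : (x : K) ≠ 0) (hadm : ∀ c ∈ ca (tower O A m), c * (x : K)⁻¹ ∈ O) :
    tower O A (m + 1) = loc O (nrm (Algebra.adjoin k (((tower O A m) : Set K) ∪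
      {y : K | ∃ c : ↥(tower O A m),
        c ∈ Literature.RingTheory.CohomologyAnnihilator.cohomologyAnnihilator ↥(tower O A m) ∧
          y = (c : K) * (x : K)⁻¹}))) := by
  rw [HomologicalConductor.PersistenceRadical.tower_succ_eq_loc_nrm_affChart O A m hTO hx hx0 hadm,
    setOf_ca_mul_inv_eq]

/-- **`K(Z) ≃ K` over `T`** for a birational `ρ : Z ⟶ Spec T`, `Z` integral, `Frac T = K`: the data
`(e, he)` of parts 1–3 (the `CentreRing` idiom: `isFractionRing_baseToFunctionField` and
`IsLocalization.algEquiv`). [cite: Hartshorne1977, proof of Cor. III.11.4 (p. 280)] -/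
theorem exists_functionField_ringEquiv (T : Subalgebra k K) [IsFractionRing ↥T K] {Z : Scheme.{0}}
    [IsIntegral Z] (ρ : Z ⟶ Spec (.of ↥T)) (hρ : IsBirational ρ) :
    ∃ e : ↑Z.functionField ≃+* K, ∀ t : ↥T, e (baseToFunctionField ρ t) = (t : K) := by
  letI := (baseToFunctionField ρ).toAlgebra
  haveI := hρ.isDominant
  haveI : IsFractionRing ↥T ↑Z.functionField :=
    isFractionRing_baseToFunctionField ρ hρ.isIso_stalkMap_genericPoint
  let eA : ↑Z.functionField ≃ₐ[↥T] K := IsLocalization.algEquiv (nonZeroDivisors ↥T) _ _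
  exact ⟨eA.toRingEquiv, fun t => eA.commutes t⟩

end Summit.ResolutionOfSingularities.ResolutionOfSingularities.Theorems.SurfaceTermination.ChartResolution

end
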